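import Literature.NumberTheory.Automorphic.BrandtModuleDictionary
import Literature.NumberTheory.Automorphic.BrandtMultiplicativity
import HarnessLib

/-!
# `brandtMatrix_mul_of_coprime` for an Eichler package follows from the invertibility of
# intermediate lattices of coprime indices

Topic `NumberTheory/Automorphic`; theorems only (no definition, no named fact, no instance).
The named fact `brandtMatrix_mul_of_coprime` of `BrandtModule.lean` (Vignéras III §5 Ex. 5.8
(c): `P(A) P(B) = P(AB)` si `(A, B) = 1`, for the Brandt data of every Eichler package) is
reduced here, package by package, to the single arithmetic input of Eichler's
unique-factorisation proof isolated in `BrandtMultiplicativity.lean`: *an intermediate lattice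
`M ⊆ K ⊆ I` of coprime indices between invertible right `O`-ideals is an invertible right
`O`-ideal* (true for Eichler orders — `K` is locally equal to `M` or to `I` — by the local
theory of orders, Voight Main Thm. 16.6.1, not in the tree). The other hypothesis of
`BrandtMultiplicativity.lean`, stability of `Brandt.rightIdeals O` under left translation by
units, holds in the (division) algebra of a package (`BrandtModuleDictionary.lean`); the passage
between the two Brandt vocabularies (class sets in bijection, matrices transposed) is the
dictionary of that file.

* `Brandt.units_smul_mem_rightIdeals_of_isTotallyDefinite` — `β I ∈ Brandt.rightIdeals O` for
  `I ∈ Brandt.rightIdeals O`, `O` an order in a totally definite quaternion algebra over `ℚ`;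
* `Brandt.XiSetup.matrix_mul_of_coprime_of_forall_mem_rightIdeals` — `T(mn) = T(m) T(n)`
  (`gcd(m, n) = 1`) for a Brandt setup, granted the intermediate-lattice hypothesis;
* `EichlerPackage.T_mul_of_coprime_of_forall_mem_rightIdeals`,
  `EichlerPackage.T_comm_of_coprime_of_forall_mem_rightIdeals` — the same for the Brandt data
  `B(·)` of an Eichler package, and `B(m) B(n) = B(n) B(m)` for coprime `m, n`;
* `brandtMatrix_mul_of_coprime_of_forall_mem_rightIdeals` — hence the named fact
  `brandtMatrix_mul_of_coprime`, granted the hypothesis for every package. (The named fact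
  `brandtMatrix_comm` asks for `m, n` prime to the level but not to each other and needs the
  Hecke recursion at `p ∤ N⁺N⁻` besides; only its coprime sub-case follows here.)

## References

* M.-F. Vignéras, *Arithmétique des algèbres de quaternions*, LNM 800 (1980), Ch. III §5
  exercice 5.8 (c)–(d) [VignerasLNM800].
* M. Eichler, LNM 320 (1973), Ch. II §6 Thm. 2 (18), (23) [Eichler1973].
* J. Voight, *Quaternion Algebras*, GTM 288 (2021), Main Thm. 16.6.1 [Voight2021].
-/

noncomputable section

open scoped Pointwise

universe u

namespace Literature.NumberTheory.Automorphic

section Definite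

variable {B : Type u} [Ring B] [Algebra ℚ B] [IsQuaternionAlgebra ℚ B]

/-- **Translates of invertible right ideals are invertible right ideals**, for an order in a
totally definite quaternion algebra over `ℚ`: `I ∈ Brandt.rightIdeals O ⇒ β I ∈
Brandt.rightIdeals O` (through `Brandt.rightIdeals O = invertibleRightIdeals O` and
`IsInvertibleRightIdeal.units_smul`). [folklore] -/
theorem Brandt.units_smul_mem_rightIdeals_of_isTotallyDefinite (hdef : IsTotallyDefinite ℚ B)
    {O : Submodule ℤ B} (hO : Brandt.IsOrder B O) {I : Submodule ℤ B}
    (hI : I ∈ Brandt.rightIdeals O) (β : Bˣ) : β • I ∈ Brandt.rightIdeals O := by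
  have hZ : IsZOrder O := isZOrder_iff_isOrder.mpr hO
  rw [rightIdeals_eq_invertibleRightIdeals_of_isTotallyDefinite hdef hZ] at hI ⊢
  exact IsInvertibleRightIdeal.units_smul β hI

end Definite

namespace Brandt

variable {Nplus Nminus : ℕ}

/-- **`T(mn) = T(m) T(n)` for coprime `m, n`, for a Brandt setup**, granted that intermediate
lattices of coprime indices between invertible right ideals of its Eichler order are invertible
right ideals (the local input of Eichler's proof). [cite: VignerasLNM800, Ch. III §5 exercice 5.8 (c)] -/
theorem XiSetup.matrix_mul_of_coprime_of_forall_mem_rightIdeals (S : XiSetup Nplus Nminus)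
    [Fintype (ClassSet S.O)] [DecidableEq (ClassSet S.O)]
    (hK : ∀ M ∈ rightIdeals S.O, ∀ I ∈ rightIdeals S.O, ∀ K : Submodule ℤ S.D, M ≤ K → K ≤ I →
      Nat.Coprime (M.toAddSubgroup.relIndex K.toAddSubgroup)
        (K.toAddSubgroup.relIndex I.toAddSubgroup) → K ∈ rightIdeals S.O)
    {m n : ℕ} (hmn : Nat.Coprime m n) : matrix S.O (m * n) = matrix S.O m * matrix S.O n :=
  haveI : IsAddTorsionFree S.D := S.isAddTorsionFree
  Brandt.matrix_mul_of_coprime_of_forall_mem_rightIdeals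
    (fun _ hI β => Brandt.units_smul_mem_rightIdeals_of_isTotallyDefinite S.isTotallyDefinite
      S.isEichlerOrder.isOrder hI β) hK hmn

end Brandt

variable {Nplus Nminus : ℕ}

/-- **`B(mn) = B(m) B(n)` for coprime `m, n`, for the Brandt data of an Eichler package**,
granted the intermediate-lattice hypothesis for its Eichler order (`B(·)` is the transpose of
`Brandt.matrix` along the bijection of class sets, `BrandtData.ofOrder_T_eq_transpose_reindex`;
transposition reverses products, and the two factors commute, both products being `T(mn)`).
[cite: VignerasLNM800, Ch. III §5 exercice 5.8 (c)] -/
theorem EichlerPackage.T_mul_of_coprime_of_forall_mem_rightIdeals (P : EichlerPackage Nplus Nminus)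
    (hK : ∀ M ∈ Brandt.rightIdeals P.O, ∀ I ∈ Brandt.rightIdeals P.O, ∀ K : Submodule ℤ P.B,
      M ≤ K → K ≤ I →
        Nat.Coprime (M.toAddSubgroup.relIndex K.toAddSubgroup)
          (K.toAddSubgroup.relIndex I.toAddSubgroup) → K ∈ Brandt.rightIdeals P.O)
    {m n : ℕ} (hmn : Nat.Coprime m n) :
    P.brandtData.T (m * n) = P.brandtData.T m * P.brandtData.T n := by
  classical
  have hO : IsZOrder P.O := P.isEichlerOrder.isZOrder
  have h : Brandt.rightIdeals P.O = invertibleRightIdeals P.O :=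
    rightIdeals_eq_invertibleRightIdeals_of_isTotallyDefinite P.isTotallyDefinite hO
  set e := Brandt.ClassSet.equivRightIdealClass h with he
  letI : Fintype (RightIdealClass P.O) := P.brandtData.instFintypeι
  letI : Fintype (Brandt.ClassSet P.O) := Fintype.ofEquiv _ e.symm
  haveI : IsAddTorsionFree P.B := isAddTorsionFree_of_charZero_module ℚ P.B
  have hcl : ∀ I ∈ Brandt.rightIdeals P.O, ∀ β : P.Bˣ, β • I ∈ Brandt.rightIdeals P.O :=
    fun _ hI β => Brandt.units_smul_mem_rightIdeals_of_isTotallyDefinite P.isTotallyDefinite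
      (isZOrder_iff_isOrder.mp hO) hI β
  have hT : ∀ s, P.brandtData.T s = (Matrix.reindex e e (Brandt.matrix P.O s)).transpose :=
    fun s => BrandtData.ofOrder_T_eq_transpose_reindex hO h s
  have hmul := Brandt.matrix_mul_of_coprime_of_forall_mem_rightIdeals hcl hK hmn.symm
  rw [hT, hT, hT, mul_comm m n, hmul]
  have hre : Matrix.reindex e e (Brandt.matrix P.O n * Brandt.matrix P.O m) =
      Matrix.reindex e e (Brandt.matrix P.O n) * Matrix.reindex e e (Brandt.matrix P.O m) := by
    simp only [Matrix.reindex_apply, Matrix.submatrix_mul_equiv]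
  exact (congrArg Matrix.transpose hre).trans (Matrix.transpose_mul _ _)

/-- **`B(m) B(n) = B(n) B(m)` for coprime `m, n`** for the Brandt data of an Eichler package,
granted the intermediate-lattice hypothesis (both sides are `B(mn)`). [cite: VignerasLNM800, Ch. III §5 exercice 5.8 (c)–(d)] -/
theorem EichlerPackage.T_comm_of_coprime_of_forall_mem_rightIdeals (P : EichlerPackage Nplus Nminus)
    (hK : ∀ M ∈ Brandt.rightIdeals P.O, ∀ I ∈ Brandt.rightIdeals P.O, ∀ K : Submodule ℤ P.B,
      M ≤ K → K ≤ I →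
        Nat.Coprime (M.toAddSubgroup.relIndex K.toAddSubgroup)
          (K.toAddSubgroup.relIndex I.toAddSubgroup) → K ∈ Brandt.rightIdeals P.O)
    {m n : ℕ} (hmn : Nat.Coprime m n) :
    P.brandtData.T m * P.brandtData.T n = P.brandtData.T n * P.brandtData.T m := by
  rw [← P.T_mul_of_coprime_of_forall_mem_rightIdeals hK hmn,
    ← P.T_mul_of_coprime_of_forall_mem_rightIdeals hK hmn.symm, mul_comm]

/-- **The named fact `brandtMatrix_mul_of_coprime` of `BrandtModule.lean` follows from the
invertibility of intermediate lattices of coprime indices** (for the invertible right ideals of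
the Eichler order of every package) — the reduction of Vignéras III Ex. 5.8 (c) / Eichler 1973
II §6 Thm. 2 (18) to its local input. [cite: VignerasLNM800, Ch. III §5 exercice 5.8 (c)] -/
theorem brandtMatrix_mul_of_coprime_of_forall_mem_rightIdeals
    (hK : ∀ (Nplus Nminus : ℕ) (P : EichlerPackage Nplus Nminus),
      ∀ M ∈ Brandt.rightIdeals P.O, ∀ I ∈ Brandt.rightIdeals P.O, ∀ K : Submodule ℤ P.B,
        M ≤ K → K ≤ I →
          Nat.Coprime (M.toAddSubgroup.relIndex K.toAddSubgroup)
            (K.toAddSubgroup.relIndex I.toAddSubgroup) → K ∈ Brandt.rightIdeals P.O) :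
    brandtMatrix_mul_of_coprime := fun Nplus Nminus P _ _ hmn =>
  P.T_mul_of_coprime_of_forall_mem_rightIdeals (hK Nplus Nminus P) hmn

end Literature.NumberTheory.Automorphic

end
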